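import Literature.NumberTheory.Weil1964.AdelicMetaplecticProductContinuity
import Literature.NumberTheory.GelbartRogawski1991.DoubledUnitarySiegelParabolicAlgebraGen
import HarnessLib
import Literature.NumberTheory.GelbartRogawski1991.DoubledWeilRepresentationAssembly

/-!
# The doubled Weil representation assembled from its finite and archimedean halves — general `E/F`

General-quadratic-extension twin (namespace `GRConstructionGen`) of `DoubledWeilRepresentationAssembly` (CM case,
namespace `GRConstruction`): the CM field `L ⊃ L⁺` with complex conjugation and `realDiagonal` Gram data is replaced by an
arbitrary quadratic extension `E/F` of number fields with `c ∈ Aut(E/F)`, `c δ = -δ ≠ 0`, `δ² = d ∈ F`, and symmetric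
invertible Gram matrices `TV`, `TW` over `F` (objects of `DoubledUnitaryGlobalSplittingDataGen`).  Statements and proofs are
verbatim transports (the group-theoretic packaging lemma `commute_abstract` is reused from the CM file).

[GelbartRogawski1991, §3.1 Prop. 3.1.1] by doubling: given a FINITE half `sf` (`IsFinHalf χ sf`, operators `1 ⊗ B`)
and an ARCHIMEDEAN half `sa` (`IsArchHalf χ sa`, operators `A ⊗ 1`) of `DoubledUnitaryGlobalSplittingData`, the map
`sD(g) := sa(g_∞) · sf(g_f)` (`assemble`; `H(𝔸) = H(L⁺ ⊗ ℝ) × H(𝔸_f)`, tree `UnitaryGroup.adelicProdEquiv ∕ archPart ∕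
finPart`, Mathlib `MonoidHom.noncommCoprod`) is a homomorphism because the halves COMMUTE (their symplectic parts
commute and `A ⊗ 1`, `1 ⊗ B` commute; joint injectivity of `(π, ω)`), lies over `ι^𝔻` (`proj_assemble`), is
continuous (`S1asm_continuous`, tree `Weil1964.continuous_mul_hom_of_arch_fin`) and satisfies the parabolic
prescription on `P_Δ(𝔸)` (`S1asm_parabolic`: `P_Δ(𝔸)` is closed under the place decomposition `p = p_∞ · p_f`
(`S1par_components`), `det_Δ`, `χ(det_Δ)`, `|det_Δ|^{1/2}` are multiplicative, and `(ω(XY)Φ)(0)` factorises).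
End theorem: `isDoubledWeilRep_assemble : IsFinHalf χ sf → IsArchHalf χ sa → IsDoubledWeilRep χ (assemble …)`.
-/

set_option autoImplicit false

noncomputable section

open scoped Classical
open scoped Matrix Kronecker TensorProduct
open NumberField IsDedekindDomain
open Literature.RepresentationTheory.HeisenbergGroup
open Literature.NumberTheory.Automorphic
open Literature.NumberTheory.Weil1964
open Literature.NumberTheory.GaloisRepresentations

namespace Literature.NumberTheory.GelbartRogawski1991.GRConstructionGen

open UnitaryDualPair

variable (F : Type) [Field F] [NumberField F] (E : Type) [Field E] [NumberField E] [Algebra F E]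
  [Algebra.IsQuadraticExtension F E]
variable (c : E ≃ₐ[F] E) {δ : E} (hcδ : c δ = -δ) (hδ : δ ≠ 0) {d : F} (hd : δ * δ = algebraMap F E d)
variable {N M n : ℕ} (e : Fin N × Fin M ≃ Fin n)
  (TV : Matrix (Fin N) (Fin N) F) (hV : TV.IsSymm) (hVd : IsUnit TV.det)
  (TW : Matrix (Fin M) (Fin M) F) (hW : TW.IsSymm) (hWd : IsUnit TW.det)

section Assembly

variable {χ : HeckeCharacter E}
  {sf : UnitaryGroup.finAdelic F E c (n + n) (hermD F E e TV TW) →* MpD F e TV TW}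
  {sa : UnitaryGroup.arch F E c (n + n) (hermD F E e TV TW) →* MpD F e TV TW}

include hVd hWd in
set_option maxHeartbeats 4000000 in
/-- the archimedean and finite halves COMMUTE in `Mp(𝕎^𝔻)ᶜᵒⁿᵗ`: their symplectic parts commute (`(g_∞, 1)` and `(1, g_f)`
commute in `H(𝔸)`, tree `commute_archToAdelic_finAdelicToAdelic`) and their operators `A ⊗ 1`, `1 ⊗ B` commute; conclude by
the joint injectivity of `(π, op)`. [cite: HarrisKudlaSweet1996, §1 (1.11)–(1.16)] -/
theorem commute_halves (hf : IsFinHalf F E c hcδ hδ hd e TV hV hVd TW hW hWd χ sf) (ha : IsArchHalf F E c hcδ hδ hd e TV hV hVd TW hW hWd χ sa)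
    (a : UnitaryGroup.arch F E c (n + n) (hermD F E e TV TW))
    (b : UnitaryGroup.finAdelic F E c (n + n) (hermD F E e TV TW)) :
    Commute (sa a) (sf b) :=
  (ha.isArch a).elim fun A hA => (hf.isFinite b).elim fun B hB =>
    GRConstruction.commute_abstract (projD F e TV TW) (adelicMpCont.omega F (Fin (n + n)) (gramDA F e TV TW))
      (eq_of_proj_eq_of_omega_eq F e TV TW) _ _
      (by
        have hpa := ha.proj_eq a
        have hpb := hf.proj_eq b
        rw [hpa, hpb]
        exact (UnitaryGroup.commute_archToAdelic_finAdelicToAdelic F E c (n + n)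
          (hermD F E e TV TW) a b).map _)
      (by
        have h := adelicTensorEnd_left_right_comm F (A : _ →ₗ[ℂ] _) B
        rw [← hA, ← hB] at h
        exact h)

/-- the assembled map `sD(g) := sa(g_∞) · sf(g_f)` (tree `adelicProdEquiv`, Mathlib `MonoidHom.noncommCoprod`).
[cite: HarrisKudlaSweet1996, §1 (1.11)–(1.16)] -/
def assemble (hf : IsFinHalf F E c hcδ hδ hd e TV hV hVd TW hW hWd χ sf) (ha : IsArchHalf F E c hcδ hδ hd e TV hV hVd TW hW hWd χ sa) :
    HA F E c e TV TW →* MpD F e TV TW :=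
  (MonoidHom.noncommCoprod sa sf (commute_halves F E c hcδ hδ hd e TV hV hVd TW hW hWd hf ha)).comp
    (MonoidHom.prod (UnitaryGroup.archPart F E c (n + n) (hermD F E e TV TW))
      (UnitaryGroup.finPart F E c (n + n) (hermD F E e TV TW)))

include hVd hWd in
set_option maxHeartbeats 1600000 in
/-- `assemble` lies over `ι^𝔻`. [cite: HarrisKudlaSweet1996, §1 (1.11)–(1.16)] -/
theorem proj_assemble (hf : IsFinHalf F E c hcδ hδ hd e TV hV hVd TW hW hWd χ sf) (ha : IsArchHalf F E c hcδ hδ hd e TV hV hVd TW hW hWd χ sa)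
    (g : HA F E c e TV TW) :
    projD F e TV TW (assemble F E c hcδ hδ hd e TV hV hVd TW hW hWd hf ha g) = toSpD F E c hcδ hδ hd e TV hV TW hW g := by
  have h1 : assemble F E c hcδ hδ hd e TV hV hVd TW hW hWd hf ha g =
      sa (UnitaryGroup.archPart F E c (n + n) (hermD F E e TV TW) g) *
        sf (UnitaryGroup.finPart F E c (n + n) (hermD F E e TV TW) g) := by
    unfold assemble
    rfl
  have h2 := UnitaryGroup.archToAdelic_mul_finAdelicToAdelic F E c (n + n)
    (hermD F E e TV TW) g
  have hpa := ha.proj_eq (UnitaryGroup.archPart F E c (n + n) (hermD F E e TV TW) g)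
  have hpb := hf.proj_eq (UnitaryGroup.finPart F E c (n + n) (hermD F E e TV TW) g)
  have h3 := (toSpD F E c hcδ hδ hd e TV hV TW hW).map_mul
    (UnitaryGroup.archToAdelic F E c (n + n) (hermD F E e TV TW)
      (UnitaryGroup.archPart F E c (n + n) (hermD F E e TV TW) g))
    (UnitaryGroup.finAdelicToAdelic F E c (n + n) (hermD F E e TV TW)
      (UnitaryGroup.finPart F E c (n + n) (hermD F E e TV TW) g))
  exact (congrArg (projD F e TV TW) h1).trans <|
    ((projD F e TV TW).map_mul _ _).trans <|
      (congrArg₂ (· * ·) hpa hpb).trans <| h3.symm.trans (congrArg _ h2)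

include hVd hWd in
/-- **S1asm-cont** (on the tree's generic lemma `Literature.NumberTheory.Weil1964.continuous_mul_hom_of_arch_fin`,
`Weil1964/AdelicMetaplecticProductContinuity.lean`):
`g ↦ sa(g_∞) sf(g_f)` is continuous for the weak topology of `Mp(𝕎^𝔻)ᶜᵒⁿᵗ`.
[cite: HarrisKudlaSweet1996, §1 (1.11)–(1.16)] -/
theorem S1asm_continuous (hf : IsFinHalf F E c hcδ hδ hd e TV hV hVd TW hW hWd χ sf) (ha : IsArchHalf F E c hcδ hδ hd e TV hV hVd TW hW hWd χ sa) :
    Continuous (assemble F E c hcδ hδ hd e TV hV hVd TW hW hWd hf ha) := by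
  have h : ⇑(assemble F E c hcδ hδ hd e TV hV hVd TW hW hWd hf ha) = fun g =>
      sa (UnitaryGroup.archPart F E c (n + n) (hermD F E e TV TW) g) *
        sf (UnitaryGroup.finPart F E c (n + n) (hermD F E e TV TW) g) := by
    funext g; unfold assemble; rfl
  rw [h]
  exact Literature.NumberTheory.Weil1964.continuous_mul_hom_of_arch_fin ha.continuous hf.continuous ha.isArch hf.isFinite
    (UnitaryGroup.continuous_archPart F E c (n + n) (hermD F E e TV TW))
    (UnitaryGroup.continuous_finPart F E c (n + n) (hermD F E e TV TW))

/-! ## The parabolic prescription of the assembled map -/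

omit [Algebra.IsQuadraticExtension F E] in
/-- **S1par-comp**: `p ∈ P_Δ(𝔸)` has both place components `(p_∞, 1)`, `(1, p_f)` in `P_Δ(𝔸)` (entrywise in
`𝔸_L = L_∞ × 𝔸_{L,f}`, tree `GLn.coe_ofInfinite_apply` ∕ `GLn.coe_ofFinite_apply`).
[cite: HarrisKudlaSweet1996, §1 (1.11)–(1.16)] -/
theorem S1par_components (p : HA F E c e TV TW) (hS : IsSiegelDelta F E c e TV TW p) :
    IsSiegelDelta F E c e TV TW
        (UnitaryGroup.archToAdelic F E c (n + n) (hermD F E e TV TW)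
          (UnitaryGroup.archPart F E c (n + n) (hermD F E e TV TW) p)) ∧
      IsSiegelDelta F E c e TV TW
        (UnitaryGroup.finAdelicToAdelic F E c (n + n) (hermD F E e TV TW)
          (UnitaryGroup.finPart F E c (n + n) (hermD F E e TV TW) p)) := by
  rw [isSiegelDelta_iff_entry] at hS
  have hXa : ∀ a b : Fin (n + n),
      ((UnitaryGroup.archToAdelic F E c (n + n) (hermD F E e TV TW)
          (UnitaryGroup.archPart F E c (n + n) (hermD F E e TV TW) p)).1 :
          Matrix (Fin (n + n)) (Fin (n + n)) (AdeleRing (𝓞 E) E)) a b =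
        ((((p : GL (Fin (n + n)) (AdeleRing (𝓞 E) E)) : Matrix _ _ (AdeleRing (𝓞 E) E)) a b).1,
          (1 : Matrix (Fin (n + n)) (Fin (n + n)) (FiniteAdeleRing (𝓞 E) E)) a b) := by
    intro a b
    change (GLn.ofInfinite (n + n) E
      (UnitaryGroup.archPart F E c (n + n) (hermD F E e TV TW) p :
        GL (Fin (n + n)) (mixedEmbedding.mixedSpace E)) : Matrix _ _ (AdeleRing (𝓞 E) E)) a b = _
    rw [GLn.coe_ofInfinite_apply]
    refine Prod.ext ?_ rfl
    exact (InfiniteAdeleRing.ringEquiv_mixedSpace E).symm_apply_apply _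
  have hXb : ∀ a b : Fin (n + n),
      ((UnitaryGroup.finAdelicToAdelic F E c (n + n) (hermD F E e TV TW)
          (UnitaryGroup.finPart F E c (n + n) (hermD F E e TV TW) p)).1 :
          Matrix (Fin (n + n)) (Fin (n + n)) (AdeleRing (𝓞 E) E)) a b =
        ((1 : Matrix (Fin (n + n)) (Fin (n + n)) (InfiniteAdeleRing E)) a b,
          ((((p : GL (Fin (n + n)) (AdeleRing (𝓞 E) E)) : Matrix _ _ (AdeleRing (𝓞 E) E)) a b).2)) := by
    intro a b
    change (GLn.ofFinite (n + n) E
      (UnitaryGroup.finPart F E c (n + n) (hermD F E e TV TW) p :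
        GL (Fin (n + n)) (FiniteAdeleRing (𝓞 E) E)) : Matrix _ _ (AdeleRing (𝓞 E) E)) a b = _
    rw [GLn.coe_ofFinite_apply]
    rfl
  constructor
  · rw [isSiegelDelta_iff_entry]
    intro i j
    rw [hXa, hXa, hXa, hXa]
    exact Prod.ext (congrArg Prod.fst (hS i j) :) (GRConstruction.one_apply_siegel (R := FiniteAdeleRing (𝓞 E) E) i j :)
  · rw [isSiegelDelta_iff_entry]
    intro i j
    rw [hXb, hXb, hXb, hXb]
    exact Prod.ext (GRConstruction.one_apply_siegel (R := InfiniteAdeleRing E) i j :) (congrArg Prod.snd (hS i j) :)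

include hVd hWd in
set_option maxHeartbeats 1600000 in
/-- **S1asm-par** (with S1par-comp): the parabolic prescription of `assemble` on `P_Δ(𝔸)` from the two
prescriptions on `P_Δ(∞)`, `P_Δ(𝔸_f)`: `p = p_∞ p_f` with both factors in `P_Δ`, `det_Δ`, `χ(det_Δ)` and `|det_Δ|^{1/2}`
multiplicative on `P_Δ(𝔸)` (`detDelta_mul`, `chiDet_mul`, `modDelta_mul` — block-triangularity in the basis adapted to `Δ`),
and `(ω(X_∞ X_f)Φ)(0) = c_∞ c_f Φ(0)` for the `δ`-conjugates (`opD_mul`).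
[cite: HarrisKudlaSweet1996, §1 (1.11)–(1.16)] -/
theorem S1asm_parabolic (hf : IsFinHalf F E c hcδ hδ hd e TV hV hVd TW hW hWd χ sf) (ha : IsArchHalf F E c hcδ hδ hd e TV hV hVd TW hW hWd χ sa) :
    ∀ (p : HA F E c e TV TW), IsSiegelDelta F E c e TV TW p → IsUnit (detDelta F E c e TV TW p) →
      ∀ Φ : piSchwartzBruhat F (Fin (n + n)),
        opD F e TV TW (rDelta F e TV hVd TW hWd * assemble F E c hcδ hδ hd e TV hV hVd TW hW hWd hf ha p *
            (rDelta F e TV hVd TW hWd)⁻¹) Φ 0 =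
          ((chiDet F E c e TV TW χ p : ℂˣ) : ℂ) * (modDelta F E c e TV TW p : ℂ) *
            (Φ : (Fin (n + n) → AdeleRing (𝓞 F) F) → ℂ) 0 := by
  intro p hS _ Φ
  obtain ⟨hSa, hSb⟩ := S1par_components F E c e TV TW p hS
  have hua := isUnit_detDelta_of_isSiegelDelta F E c e TV TW _ hSa
  have hub := isUnit_detDelta_of_isSiegelDelta F E c e TV TW _ hSb
  have hpa := ha.parabolic _ hSa hua
  have hpb := hf.parabolic _ hSb hub
  have h1 : assemble F E c hcδ hδ hd e TV hV hVd TW hW hWd hf ha p =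
      sa (UnitaryGroup.archPart F E c (n + n) (hermD F E e TV TW) p) *
        sf (UnitaryGroup.finPart F E c (n + n) (hermD F E e TV TW) p) := by
    unfold assemble
    rfl
  have h2 := UnitaryGroup.archToAdelic_mul_finAdelicToAdelic F E c (n + n)
    (hermD F E e TV TW) p
  have hconj : rDelta F e TV hVd TW hWd * assemble F E c hcδ hδ hd e TV hV hVd TW hW hWd hf ha p *
      (rDelta F e TV hVd TW hWd)⁻¹ =
      rDelta F e TV hVd TW hWd *
          sa (UnitaryGroup.archPart F E c (n + n) (hermD F E e TV TW) p) *
          (rDelta F e TV hVd TW hWd)⁻¹ *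
        (rDelta F e TV hVd TW hWd *
          sf (UnitaryGroup.finPart F E c (n + n) (hermD F E e TV TW) p) *
          (rDelta F e TV hVd TW hWd)⁻¹) :=
    (congrArg (fun q => rDelta F e TV hVd TW hWd * q * (rDelta F e TV hVd TW hWd)⁻¹) h1).trans
      (map_mul (MulAut.conj (rDelta F e TV hVd TW hWd)) _ _)
  -- re-spell the two prescriptions with the atoms of `h2` (codomain `(adelicGroupData …).Adelic`), so that `ring` sees
  -- syntactically identical atoms
  have hpa' : ∀ Ψ : piSchwartzBruhat F (Fin (n + n)),
      opD F e TV TW (rDelta F e TV hVd TW hWd *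
          sa (UnitaryGroup.archPart F E c (n + n) (hermD F E e TV TW) p) *
          (rDelta F e TV hVd TW hWd)⁻¹) Ψ 0 =
        ((chiDet F E c e TV TW χ
            (UnitaryGroup.archToAdelic F E c (n + n) (hermD F E e TV TW)
              (UnitaryGroup.archPart F E c (n + n) (hermD F E e TV TW) p)) : ℂˣ) : ℂ) *
          (modDelta F E c e TV TW
            (UnitaryGroup.archToAdelic F E c (n + n) (hermD F E e TV TW)
              (UnitaryGroup.archPart F E c (n + n) (hermD F E e TV TW) p)) : ℂ) *
          (Ψ : (Fin (n + n) → AdeleRing (𝓞 F) F) → ℂ) 0 := hpa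
  have hpb' : ∀ Ψ : piSchwartzBruhat F (Fin (n + n)),
      opD F e TV TW (rDelta F e TV hVd TW hWd *
          sf (UnitaryGroup.finPart F E c (n + n) (hermD F E e TV TW) p) *
          (rDelta F e TV hVd TW hWd)⁻¹) Ψ 0 =
        ((chiDet F E c e TV TW χ
            (UnitaryGroup.finAdelicToAdelic F E c (n + n) (hermD F E e TV TW)
              (UnitaryGroup.finPart F E c (n + n) (hermD F E e TV TW) p)) : ℂˣ) : ℂ) *
          (modDelta F E c e TV TW
            (UnitaryGroup.finAdelicToAdelic F E c (n + n) (hermD F E e TV TW)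
              (UnitaryGroup.finPart F E c (n + n) (hermD F E e TV TW) p)) : ℂ) *
          (Ψ : (Fin (n + n) → AdeleRing (𝓞 F) F) → ℂ) 0 := hpb
  have hL := (congrArg (fun q => opD F e TV TW q Φ 0) hconj).trans
    ((congr_fun (opD_mul F e TV TW _ _ Φ) 0).trans ((hpa' _).trans (congrArg (_ * ·) (hpb' Φ))))
  have hχ := (congrArg (chiDet F E c e TV TW χ) h2.symm).trans (chiDet_mul F E c e TV TW χ hSa hSb)
  have hm := (congrArg (modDelta F E c e TV TW) h2.symm).trans (modDelta_mul F E c e TV TW hSa hSb)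
  refine hL.trans ?_
  rw [hχ, hm, Units.val_mul, Complex.ofReal_mul]
  ring

include hVd hWd in
/-- **S1asm — the doubled Weil representation assembled** from `commute_halves`, `proj_assemble`, `S1asm_parabolic` and `S1asm_continuous`.
[cite: HarrisKudlaSweet1996, §1 (1.11)–(1.16)] -/
theorem isDoubledWeilRep_of_halves (χ : HeckeCharacter E)
    {sf : UnitaryGroup.finAdelic F E c (n + n) (hermD F E e TV TW) →* MpD F e TV TW}
    {sa : UnitaryGroup.arch F E c (n + n) (hermD F E e TV TW) →* MpD F e TV TW}
    (hf : IsFinHalf F E c hcδ hδ hd e TV hV hVd TW hW hWd χ sf) (ha : IsArchHalf F E c hcδ hδ hd e TV hV hVd TW hW hWd χ sa) :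
    ∃ sD : HA F E c e TV TW →* MpD F e TV TW, IsDoubledWeilRep F E c hcδ hδ hd e TV hV hVd TW hW hWd χ sD :=
  ⟨assemble F E c hcδ hδ hd e TV hV hVd TW hW hWd hf ha,
    { continuous := S1asm_continuous F E c hcδ hδ hd e TV hV hVd TW hW hWd hf ha
      proj_eq := proj_assemble F E c hcδ hδ hd e TV hV hVd TW hW hWd hf ha
      parabolic := S1asm_parabolic F E c hcδ hδ hd e TV hV hVd TW hW hWd hf ha }⟩

end Assembly

end Literature.NumberTheory.GelbartRogawski1991.GRConstructionGen
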